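import Summits.AtomisticToContinuum.Crystallization.Theorems.FrustratedLawDichotomyStrainedPatchHomEntryFitKit

/-!
# The reflected (P1) FIT prune on entry boxes: «centre `1/20`-good ⟹ `PruneFcc U`» decided in the `Numerics.FI` kernel, and the fcc half of
# `homFloor_of_prunedBoxSums_selfAdjoint` from ONE tree verdict with (P1) ∨ (P4) leaves

decomp-a2c hand-2 g22 (crux `AperiodicFrustratedLawGap`, stmt-AtomisticToContinuum-27623; sequel of `…HomEntryGram` / `…HomEntryFitKit`; critic rows 758 /
764 (C) / 783 (4)(iii) / 801).  Near the unstrained lattices (`U ≈ λ·1`) the box floor (P4) is FALSE at `m = 1/625` (site surplus `≈ −1.1·10⁻³`, row 764 (B));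
there the certificate must use (P1): the centre of every locally-`U·L_fcc` configuration is `1/20`-GOOD, hence `TightNearCap`, hence the prune disjunct.

* §1 ★★ `goodAtScale_of_fitBounds` (DEF-FREE real theorem): for `‖U − 1‖ ≤ 1/4` and two numbers `0 < dlo ≤ dhi ≤ 3/2` with `8 (13/10·dhi + 1/100)² < 27`,
  if (d) `dlo ≤ ‖U q‖` for all twelve `q ∈ fccKissingPattern` and `‖U q‖ ≤ dhi` for one, (F1) the fit `‖U q − ‖U q'‖ q‖² ≤ η'²·d2lo` for all
  pattern points `q, q'` with `d2lo ≤ ‖U q‖²` (`η' = 49/1000`; the true scale `d = min_q' ‖U q'‖` is one of them), (F2) `‖U q‖ ≤ 13/10·dlo − 1/100`, and (F3) every label `b ∈ [−2,2]³ ∖ 0` off the kissing shell has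
  `13/10·dhi + 1/100 ≤ ‖latPt U fccVec b‖`, then `GoodAtScale (1/20) (3/2) z c` at the centre of every locally homogeneous ball (`hT` at `15/2`) — by
  `…HomPrunesFit.goodAtScale_centre_of_fit_fcc` with `d := min_q ‖U q‖`, `A := id`, `t' q := U q`, `γ := 1/100`; the index box `[−2,2]³` is
  `…HomLatticeBox.mem_box_of_norm_fccPoint_lt` (`K = 2`);
* §2 the kernel verdict ★ `fitOK c w`: CANCELLATION-FREE evaluation about the nominal scale `λ = scaleL c ≥ 0` (mean diagonal of the centre) — with
  `V = U − λ·1` (entries `devFI`, SMALL intervals), `‖U q‖² = λ² + 2λ⟪Vq, q⟫ + ‖Vq‖²` (`kissSq`), `d ∈ dEncl = FI.sqrt [lmin lo, lmin hi]`, and the misfit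
  bound `‖U q − ‖U q'‖ q‖ ≤ ‖Vq‖ + ‖Vq'‖ ≤ 2ρ`, `ρ² = devMax` (max over the kissing labels of the upper ends of `‖Vq‖²`), whose size is `O((strain + width)²)`
  — so leaves near the unstrained ray may be LARGE (half-width `2⁻⁸` passes at `U = 1`, smoke test);
  ★★ `fitOK_sound : fitOK c w = true ⟹ PruneFcc U` for every `U` with `‖U − 1‖ ≤ 1/4` and entries in the box (off-shell labels over `box2 = [−2,2]³`);
* §3 the combined entry-leaf verdict `entryLeafOKF μ := fitOK ∨ entryLeafOK μ` ((P1) ∨ symmetry ∨ column ∨ (P4)), its soundness, and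
  ★★★ `fccHalf_of_entryFitTree : 2(m + e_W)SC ≤ μ → treeOK (entryLeafOKF μ) t rootC rootW = true → hfcc` (the fcc hypothesis of
  `…HomPrunedPolar.homFloor_of_prunedBoxSums_selfAdjoint`, verbatim).

All definitions computable; 0 sorry; standard axioms; no instances / notation.  `--supports stmt-AtomisticToContinuum-27623`.
-/

namespace Summit.AtomisticToContinuum.Crystallization.Theorems.FrustratedLawDichotomyStrainedPatchHomEntryFit

open scoped BigOperators RealInnerProductSpace
open Literature.Analysis.ValidatedNumerics.Numerics
open Literature.Geometry.DiscreteGeometry (fccKissingPattern fccInt card_fccKissingPattern norm_eq_one_of_mem_fccKissingPattern)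
open Summit.AtomisticToContinuum.Crystallization.Theorems.ChargedEnergyGapNegative (E3)
open Summit.AtomisticToContinuum.Crystallization.Theorems.FrustratedLawDichotomySchurCut (effPot w₄₅ ω₄)
open Summit.AtomisticToContinuum.Crystallization.Theorems.FrustratedLawDichotomyMotifLemmas (GoodAtScale)
open Summit.AtomisticToContinuum.Crystallization.Theorems.FrustratedLawDichotomyAveragingRuleTightFree (TightNearCap BadNearCap)
open Summit.AtomisticToContinuum.Crystallization.Theorems.FrustratedLawDichotomyExemptAbsorption (ExemptNear)
open Summit.AtomisticToContinuum.Crystallization.Theorems.FrustratedLawDichotomyStrainedPatchHomSplit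
open Summit.AtomisticToContinuum.Crystallization.Theorems.FrustratedLawDichotomyStrainedPatchHomRelief (latPt_fccVec_eq)
open Summit.AtomisticToContinuum.Crystallization.Theorems.FrustratedLawDichotomyStrainedPatchHomLatticeBox
  (norm_apply_ge_of_near_one latPt_zero mem_box_of_norm_fccPoint_lt)
open Summit.AtomisticToContinuum.Crystallization.Theorems.FrustratedLawDichotomyStrainedPatchHomPrunesFit (goodAtScale_centre_of_fit_fcc)
open Summit.AtomisticToContinuum.Crystallization.Theorems.FrustratedLawDichotomyStrainedPatchHomPruned (pruneFcc_of_centre_good)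
open Summit.AtomisticToContinuum.Crystallization.Theorems.FrustratedLawDichotomyStrainedPatchHomPolar (norm_apply_le_of_norm_sub_one_le)
open Summit.AtomisticToContinuum.Crystallization.Theorems.FrustratedLawDichotomyStrainedPatchHomCertTree
open Summit.AtomisticToContinuum.Crystallization.Theorems.FrustratedLawDichotomyStrainedPatchHomEntryGram
open Summit.AtomisticToContinuum.Crystallization.Theorems.FrustratedLawDichotomyStrainedPatchHomEntryFitKit
open Literature.Barriers.AtomisticToContinuum.FlatleyTheil2015 (fccVec fccPoint)

/-! ## §1. The real fit theorem -/

/-- ★★ **CENTRE `1/20`-GOOD FROM FIT BOUNDS** (def-free).  See the module docstring for (d), (F1)–(F3). [folklore] -/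
theorem goodAtScale_of_fitBounds (U : E3 →L[ℝ] E3) (hU : ‖U - 1‖ ≤ 1 / 4) {dlo dhi : ℝ} (hdlo : 0 < dlo) (hdhi : dhi ≤ 3 / 2)
    (hthr : 8 * (13 / 10 * dhi + 1 / 100) ^ 2 < 27)
    (hlo : ∀ q ∈ fccKissingPattern, dlo ≤ ‖U q‖) (hhi : ∃ q ∈ fccKissingPattern, ‖U q‖ ≤ dhi)
    {d2lo : ℝ} (hd2 : ∀ q ∈ fccKissingPattern, d2lo ≤ ‖U q‖ ^ 2)
    (hfit : ∀ q ∈ fccKissingPattern, ∀ q' ∈ fccKissingPattern, ‖U q - ‖U q'‖ • q‖ ^ 2 ≤ (49 / 1000 : ℝ) ^ 2 * d2lo)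
    (hcl : ∀ q ∈ fccKissingPattern, ‖U q‖ ≤ 13 / 10 * dlo - 1 / 100)
    (hfar : ∀ b ∈ (Fintype.piFinset fun _ : Fin 3 => Finset.Icc (-2 : ℤ) 2), b ≠ 0 → recon b ∉ fccInt →
      13 / 10 * dhi + 1 / 100 ≤ ‖latPt U fccVec b‖) :
    ∀ (M : ℕ) (z : Fin M → E3) (c : Fin M), Function.Injective z →
      (∀ x : E3, dist x (z c) < 15 / 2 → (x ∈ Set.range z ↔ x - z c ∈ {v : E3 | ∃ b : Fin 3 → ℤ, v = latPt U fccVec b})) →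
      GoodAtScale (1 / 20) (3 / 2) z c := by
  intro M z c _hz hT
  have hne : fccKissingPattern.Nonempty := by rw [← Finset.card_pos, card_fccKissingPattern]; norm_num
  obtain ⟨q₀, hq₀, hdq₀⟩ := Finset.exists_mem_eq_inf' hne (fun q : E3 => ‖U q‖)
  -- `d := ‖U q₀‖` is the minimum over the pattern
  have hd_le : ∀ q ∈ fccKissingPattern, ‖U q₀‖ ≤ ‖U q‖ := fun q hq => by rw [← hdq₀]; exact Finset.inf'_le _ hq
  have hdlo_d : dlo ≤ ‖U q₀‖ := hlo q₀ hq₀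
  have hd_dhi : ‖U q₀‖ ≤ dhi := by obtain ⟨q, hq, h⟩ := hhi; exact (hd_le q hq).trans h
  have hd0 : 0 < ‖U q₀‖ := hdlo.trans_le hdlo_d
  have hmemT : ∀ q ∈ fccKissingPattern, U q ∈ {v : E3 | ∃ b : Fin 3 → ℤ, v = latPt U fccVec b} := fun q hq => by
    obtain ⟨b, _, rfl⟩ := exists_label_of_mem_pattern hq
    exact ⟨b, (latPt_fccVec_eq U b).symm⟩
  -- index box for short lattice vectors
  have hbox2 : ∀ b : Fin 3 → ℤ, ‖latPt U fccVec b‖ < 13 / 10 * ‖U q₀‖ + 1 / 100 →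
      b ∈ Fintype.piFinset fun _ : Fin 3 => Finset.Icc (-(2 : ℕ) : ℤ) (2 : ℕ) := fun b hb => by
    refine mem_box_of_norm_fccPoint_lt (R := 13 / 10 * dhi + 1 / 100) (by push_cast; linarith) ?_
    have h34 := norm_apply_ge_of_near_one hU (fccPoint b)
    rw [← latPt_fccVec_eq] at h34
    linarith
  refine goodAtScale_centre_of_fit_fcc hT (d := ‖U q₀‖) (η' := 49 / 1000) (γ := 1 / 100) (A := LinearIsometry.id)
    (t' := fun u => U (u : E3)) (hd_dhi.trans hdhi) hd0 (by norm_num) (by norm_num) (by linarith) ?_ ?_ ?_ ?_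
  · -- (hfit)
    intro u
    have hu1 : ‖(u : E3)‖ = 1 := norm_eq_one_of_mem_fccKissingPattern u.2
    refine ⟨hmemT u u.2, ?_, ?_⟩
    · have := norm_apply_le_of_norm_sub_one_le hU (u : E3)
      rw [hu1] at this
      show ‖U (u : E3)‖ < 15 / 2
      linarith
    · have g := hfit u u.2 q₀ hq₀
      have h2 := hd2 q₀ hq₀
      have hsq : ‖U (u : E3) - ‖U q₀‖ • (u : E3)‖ ^ 2 ≤ (49 / 1000 * ‖U q₀‖) ^ 2 := by linarith
      show ‖U (u : E3) - ‖U q₀‖ • (LinearIsometry.id (u : E3))‖ ≤ 49 / 1000 * ‖U q₀‖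
      rw [LinearIsometry.id_apply]
      exact (abs_le_of_sq_le_sq' hsq (by positivity)).2
  · -- (hlow)
    rintro w ⟨b, rfl⟩ hw0 hlt
    by_cases hrec : recon b ∈ fccInt
    · rw [latPt_fccVec_eq]; exact hd_le _ (fccPoint_mem_pattern_of_recon hrec)
    · exfalso
      have hb0 : b ≠ 0 := by rintro rfl; exact hw0 (latPt_zero U fccVec)
      have hmem := hbox2 b hlt
      have := hfar b (by simpa using hmem) hb0 hrec
      linarith
  · -- (hex)
    refine ⟨U q₀, hmemT q₀ hq₀, fun h0 => ?_, le_rfl⟩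
    rw [h0, norm_zero] at hd0
    exact lt_irrefl _ hd0
  · -- (hclean)
    rintro w ⟨b, rfl⟩ hw0 hlt
    by_cases hrec : recon b ∈ fccInt
    · have hpat := fccPoint_mem_pattern_of_recon hrec
      refine ⟨?_, ⟨⟨fccPoint b, hpat⟩, (latPt_fccVec_eq U b).symm⟩⟩
      rw [latPt_fccVec_eq]
      linarith [hcl _ hpat]
    · exfalso
      have hb0 : b ≠ 0 := by rintro rfl; exact hw0 (latPt_zero U fccVec)
      have hmem := hbox2 b hlt
      have := hfar b (by simpa using hmem) hb0 hrec
      linarith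

/-! ## §2. The kernel verdict and its soundness -/

/-- `{−2, …, 2}` as a computable `Finset` (image of `range 5`). -/
def icc2 : Finset ℤ := (Finset.range 5).image fun n : ℕ => (n : ℤ) - 2
/-- `icc2 = [−2, 2]`. [formal bookkeeping] -/
theorem icc2_eq : icc2 = Finset.Icc (-2 : ℤ) 2 := by
  ext x
  simp only [icc2, Finset.mem_image, Finset.mem_range, Finset.mem_Icc]
  constructor
  · rintro ⟨n, hn, rfl⟩; omega
  · rintro ⟨h1, h2⟩; exact ⟨(x + 2).toNat, by omega, by omega⟩
/-- The computable index box `[−2,2]³`. -/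
def box2 : Finset (Fin 3 → ℤ) := Fintype.piFinset fun _ : Fin 3 => icc2
/-- `box2 = [−2,2]³`. [formal bookkeeping] -/
theorem box2_eq : box2 = Fintype.piFinset fun _ : Fin 3 => Finset.Icc (-2 : ℤ) 2 := by
  unfold box2; rw [icc2_eq]
/-- Nominal scale of the box: the mean diagonal of the centre (scaled). -/
def scaleL (c : Fin 3 × Fin 3 → ℤ) : ℤ := (c (0, 0) + c (1, 1) + c (2, 2)) / 3
/-- Entry intervals of the DEVIATION `V = U − λ·1` (`λ = L/SC`): `entryFI − λ δ`. -/
def devFI (c w : Fin 3 × Fin 3 → ℤ) (L : ℤ) (ab : Fin 3 × Fin 3) : FI :=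
  (entryFI c w ab).sub (FI.ofScaled (if ab.1 = ab.2 then L else 0))
/-- Gram table of `V` (encloses `⟪V fᵢ, V fⱼ⟫`). -/
def gramD (c w : Fin 3 × Fin 3 → ℤ) (L : ℤ) : Fin 3 → Fin 3 → FI := fun i j => gramFI (devFI c w L) i j
/-- Half-Gram table of `V` (encloses `⟪V fᵢ, fⱼ⟫`). -/
def hgramD (c w : Fin 3 × Fin 3 → ℤ) (L : ℤ) : Fin 3 → Fin 3 → FI := fun i j => hgramFI (devFI c w L) i j
/-- `‖U x_b‖² = λ² + 2λ⟪V x_b, x_b⟫ + ‖V x_b‖²` for a kissing label `b` (`‖x_b‖ = 1`), in the kernel. -/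
def kissSq (c w : Fin 3 × Fin 3 → ℤ) (L : ℤ) (b : Fin 3 → ℤ) : FI :=
  ((FI.ofScaled L).mul (FI.ofScaled L)).add ((((FI.ofScaled L).mul (qformFI (hgramD c w L) b)).mulInt 2).add (qformFI (gramD c w L) b))
/-- Enclosure of `d² = min_q ‖U q‖²` over the twelve kissing vectors. -/
def dSq (c w : Fin 3 × Fin 3 → ℤ) (L : ℤ) : FI :=
  ⟨lmin (K12.map fun b => (kissSq c w L b).lo), lmin (K12.map fun b => (kissSq c w L b).hi)⟩
/-- Enclosure of `d = min_q ‖U q‖`. -/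
def dEncl (c w : Fin 3 × Fin 3 → ℤ) (L : ℤ) : FI := FI.sqrt (dSq c w L)
/-- Maximum of a list of integers (`0` on the empty list). -/
def lmax : List ℤ → ℤ
  | [] => 0
  | [x] => x
  | x :: y :: l => max x (lmax (y :: l))
/-- `x ≤ lmax l` for every `x ∈ l`. [formal bookkeeping] -/
theorem le_lmax_of_mem : ∀ (l : List ℤ) (x : ℤ), x ∈ l → x ≤ lmax l
  | [], x, hx => by simp at hx
  | [y], x, hx => by simp at hx; subst hx; simp [lmax]
  | y :: z :: l, x, hx => by
    rw [lmax]
    rcases List.mem_cons.1 hx with rfl | hx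
    · exact le_max_left _ _
    · exact (le_lmax_of_mem (z :: l) x hx).trans (le_max_right _ _)
/-- `ρ²`: the largest upper end of `‖V q‖²` over the twelve kissing labels (scaled). -/
def devMax (c w : Fin 3 × Fin 3 → ℤ) (L : ℤ) : ℤ := lmax (K12.map fun b => (qformFI (gramD c w L) b).hi)
/-- ★ **THE (P1) FIT VERDICT on an entry box** (scaled integers; `L = scaleL c`, `D = dEncl`, `Dsq = dSq`, `S b = kissSq`, `N b = qformFI (gramT c w) b`):
`0 ≤ L`, `0 < D.lo ≤ D.hi ≤ 3SC/2`, `8 thr² < 27` (`thr = 13 D.hi/10 + SC/100`), `SC ≤ 130 D.lo`; the fit `4·10⁶ ρ² ≤ 2401 Dsq.lo` (misfit `≤ 2ρ ≤ (49/1000) d`);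
per kissing label the clean gap `S.hi ≤ (13 D.lo/10 − SC/100)²`; per off-shell label of `[−2,2]³` the far bound `thr² ≤ N.lo`. -/
def fitOK (c w : Fin 3 × Fin 3 → ℤ) : Bool :=
  let L := scaleL c
  decide (0 ≤ L) && decide (0 < (dEncl c w L).lo) && decide ((dEncl c w L).lo ≤ (dEncl c w L).hi) && decide (2 * (dEncl c w L).hi ≤ 3 * (SC : ℤ)) &&
  decide (8 * (130 * (dEncl c w L).hi + SC) ^ 2 < 270000 * ((SC : ℤ) * SC)) && decide ((SC : ℤ) ≤ 130 * (dEncl c w L).lo) &&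
  decide (4000000 * devMax c w L ≤ 2401 * (dSq c w L).lo) &&
  K12.all (fun b => decide ((kissSq c w L b).hi * SC * 10000 ≤ (130 * (dEncl c w L).lo - SC) ^ 2)) &&
  decide (∀ b ∈ box2, b ≠ 0 → recon b ∉ fccInt → (130 * (dEncl c w L).hi + (SC : ℤ)) ^ 2 ≤ (qformFI (gramT c w) b).lo * SC * 10000)

/-- Entries of the deviation `V = U − λ·1` lie in `devFI`. [formal bookkeeping] -/
theorem mem_devFI (U : E3 →L[ℝ] E3) {c w : Fin 3 × Fin 3 → ℤ} (L : ℤ)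
    (hbox : ∀ ab : Fin 3 × Fin 3, |(U (EuclideanSpace.single ab.2 (1 : ℝ))) ab.1 - (c ab : ℝ) / SC| ≤ (w ab : ℝ) / SC) (ab : Fin 3 × Fin 3) :
    FI.mem (((U - ((L : ℝ) / SC) • (1 : E3 →L[ℝ] E3)) (EuclideanSpace.single ab.2 (1 : ℝ))) ab.1) (devFI c w L ab) := by
  have e : ((U - ((L : ℝ) / SC) • (1 : E3 →L[ℝ] E3)) (EuclideanSpace.single ab.2 (1 : ℝ))) ab.1 =
      (U (EuclideanSpace.single ab.2 (1 : ℝ))) ab.1 - (((if ab.1 = ab.2 then L else 0 : ℤ)) : ℝ) / SC := by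
    by_cases hab : ab.1 = ab.2
    · simp [hab]
    · simp [hab]
  rw [e]
  exact FI.mem_sub (mem_entryFI (hbox ab)) (FI.mem_ofScaled _)

/-- ★★ **SOUNDNESS OF THE FIT VERDICT**: `fitOK c w = true` ⟹ the prune disjunct `PruneFcc U` for every `U` with `‖U − 1‖ ≤ 1/4` whose entries lie in
the box. [folklore] -/
theorem fitOK_sound {c w : Fin 3 × Fin 3 → ℤ} (h : fitOK c w = true) (U : E3 →L[ℝ] E3) (hU : ‖U - 1‖ ≤ 1 / 4)
    (hbox : ∀ ab : Fin 3 × Fin 3, |(U (EuclideanSpace.single ab.2 (1 : ℝ))) ab.1 - (c ab : ℝ) / SC| ≤ (w ab : ℝ) / SC) :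
    ∀ (M : ℕ) (z : Fin M → E3) (c : Fin M), Function.Injective z →
      Set.range z = {x : E3 | dist x (z c) ≤ 133 / 10 ∧ ∃ a : Fin 3 → ℤ, x = z c + latPt U fccVec a} →
      TightNearCap (9 / 5) (3 / 2) z c ∨ ExemptNear (9 / 5) ExRec z c ∨ BadNearCap (9 / 5) (3 / 2) z c := by
  simp only [fitOK, Bool.and_eq_true, decide_eq_true_eq, List.all_eq_true] at h
  obtain ⟨⟨⟨⟨⟨⟨⟨⟨hL0, h0⟩, h01⟩, h32⟩, hthr⟩, h130⟩, hfitZ⟩, hK⟩, hfar⟩ := h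
  have hS := SC_pos
  have hne := SC_ne
  -- the deviation `V = U − λ·1` and the real identities
  set lam : ℝ := (scaleL c : ℝ) / SC with hlam
  have hlam0 : 0 ≤ lam := div_nonneg (by exact_mod_cast hL0) hS.le
  set V : E3 →L[ℝ] E3 := U - lam • (1 : E3 →L[ℝ] E3) with hVdef
  have hV : ∀ x : E3, U x = lam • x + V x := fun x => by
    have : V x = U x - lam • x := by simp [hVdef]
    rw [this]; abel
  have hE' := mem_devFI U (scaleL c) hbox
  have hN' : ∀ b, FI.mem (‖V (fccPoint b)‖ ^ 2) (qformFI (gramD c w (scaleL c)) b) := fun b => by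
    rw [← latPt_fccVec_eq, FrustratedLawDichotomyStrainedPatchHomGram.norm_sq_latPt_eq_sum_gram]
    exact mem_qformFI (fun i j => mem_gramFI V hE' i j) b
  have hP' : ∀ b, FI.mem ⟪V (fccPoint b), fccPoint b⟫ (qformFI (hgramD c w (scaleL c)) b) := fun b => by
    rw [inner_apply_fccPoint_eq_sum]
    exact mem_qformFI (fun i j => mem_hgramFI V hE' i j) b
  have hN : ∀ b, FI.mem (‖latPt U fccVec b‖ ^ 2) (qformFI (gramT c w) b) := fun b => mem_normSq_latPt U hbox b
  have hlamm : FI.mem lam (FI.ofScaled (scaleL c)) := FI.mem_ofScaled (scaleL c)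
  -- kissing labels: `‖U q‖² = λ² + 2λ⟪Vq,q⟫ + ‖Vq‖²`
  have hkiss : ∀ b ∈ K12, FI.mem (‖U (fccPoint b)‖ ^ 2) (kissSq c w (scaleL c) b) := fun b hb => by
    have hq1 : ‖fccPoint b‖ = 1 := norm_eq_one_of_mem_fccKissingPattern (fccPoint_mem_pattern hb)
    have e : ‖U (fccPoint b)‖ ^ 2 = lam * lam + (lam * ⟪V (fccPoint b), fccPoint b⟫ * ((2 : ℤ) : ℝ) + ‖V (fccPoint b)‖ ^ 2) := by
      rw [hV, norm_add_sq_real, norm_smul, Real.norm_eq_abs, hq1, real_inner_smul_left, real_inner_comm]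
      push_cast; rw [mul_one, sq_abs]; ring
    rw [e]
    exact FI.mem_add (FI.mem_mul hlamm hlamm) (FI.mem_add (FI.mem_mulInt (FI.mem_mul hlamm (hP' b)) 2) (hN' b))
  -- `ρ²` bounds every `‖V q‖²`
  have hrho : ∀ b ∈ K12, ‖V (fccPoint b)‖ ^ 2 * SC ≤ (devMax c w (scaleL c) : ℝ) := fun b hb => by
    have h1 := (FI.mem_def.1 (hN' b)).2
    have h2 : (qformFI (gramD c w (scaleL c)) b).hi ≤ devMax c w (scaleL c) := le_lmax_of_mem _ _ (List.mem_map.2 ⟨b, hb, rfl⟩)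
    have h2' : ((qformFI (gramD c w (scaleL c)) b).hi : ℝ) ≤ devMax c w (scaleL c) := by exact_mod_cast h2
    exact h1.trans h2'
  -- the minimum `d` of the twelve lengths and its enclosures
  have hneP : fccKissingPattern.Nonempty := by rw [← Finset.card_pos, card_fccKissingPattern]; norm_num
  obtain ⟨q₀, hq₀, hdq₀⟩ := Finset.exists_mem_eq_inf' hneP (fun q : E3 => ‖U q‖)
  have hd_le : ∀ q ∈ fccKissingPattern, ‖U q₀‖ ≤ ‖U q‖ := fun q hq => by rw [← hdq₀]; exact Finset.inf'_le _ hq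
  have hd0 : 0 ≤ ‖U q₀‖ := norm_nonneg _
  have hDsq_lo : ∀ q ∈ fccKissingPattern, ((dSq c w (scaleL c)).lo : ℝ) ≤ ‖U q‖ ^ 2 * SC := fun q hq => by
    obtain ⟨b, hb, rfl⟩ := exists_label_of_mem_pattern hq
    have h1 : lmin (K12.map fun b => (kissSq c w (scaleL c) b).lo) ≤ (kissSq c w (scaleL c) b).lo :=
      lmin_le_of_mem _ _ (List.mem_map.2 ⟨b, hb, rfl⟩)
    have h1' : ((lmin (K12.map fun b => (kissSq c w (scaleL c) b).lo) : ℤ) : ℝ) ≤ (kissSq c w (scaleL c) b).lo := by exact_mod_cast h1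
    exact h1'.trans (FI.mem_def.1 (hkiss b hb)).1
  have hmemDsq : FI.mem (‖U q₀‖ ^ 2) (dSq c w (scaleL c)) := by
    refine ⟨hDsq_lo q₀ hq₀, ?_⟩
    have hl : (K12.map fun b => (kissSq c w (scaleL c) b).hi) ≠ [] := by simp [K12]
    obtain ⟨b', hb', he⟩ := List.mem_map.1 (lmin_mem _ hl)
    have hpat := fccPoint_mem_pattern hb'
    have h2 := (FI.mem_def.1 (hkiss b' hb')).2
    have hle : ‖U q₀‖ ^ 2 ≤ ‖U (fccPoint b')‖ ^ 2 := pow_le_pow_left₀ hd0 (hd_le _ hpat) 2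
    have hle' := mul_le_mul_of_nonneg_right hle hS.le
    show ‖U q₀‖ ^ 2 * SC ≤ (((dSq c w (scaleL c)).hi : ℤ) : ℝ)
    rw [show (dSq c w (scaleL c)).hi = lmin (K12.map fun b => (kissSq c w (scaleL c) b).hi) from rfl, ← he]
    linarith
  have hmemD : FI.mem ‖U q₀‖ (dEncl c w (scaleL c)) := by
    have := FI.mem_sqrt hmemDsq
    rwa [Real.sqrt_sq hd0] at this
  obtain ⟨hDlo, hDhi⟩ := FI.mem_def.1 hmemD
  have h0' : (0 : ℝ) < (dEncl c w (scaleL c)).lo := by exact_mod_cast h0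
  have hDhi0 : (0 : ℝ) ≤ (dEncl c w (scaleL c)).hi := by exact_mod_cast (h0.le.trans h01)
  refine pruneFcc_of_centre_good (goodAtScale_of_fitBounds U hU (dlo := ((dEncl c w (scaleL c)).lo : ℝ) / SC)
    (dhi := ((dEncl c w (scaleL c)).hi : ℝ) / SC) (d2lo := ((dSq c w (scaleL c)).lo : ℝ) / SC) (div_pos h0' hS) ?_ ?_ ?_ ?_ ?_ ?_ ?_ ?_)
  · -- dhi ≤ 3/2
    rw [div_le_iff₀ hS]
    have : (2 : ℝ) * (dEncl c w (scaleL c)).hi ≤ 3 * SC := by exact_mod_cast h32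
    linarith
  · -- 8 thr² < 27
    have hthr' : (8 : ℝ) * (130 * (dEncl c w (scaleL c)).hi + SC) ^ 2 < 270000 * (SC * SC) := by exact_mod_cast hthr
    have e : (13 : ℝ) / 10 * ((dEncl c w (scaleL c)).hi / SC) + 1 / 100 = (130 * (dEncl c w (scaleL c)).hi + SC) / (100 * SC) := by
      field_simp; ring
    rw [e, div_pow, show (8 : ℝ) * ((130 * ((dEncl c w (scaleL c)).hi : ℝ) + SC) ^ 2 / (100 * SC) ^ 2) =
      (8 * (130 * ((dEncl c w (scaleL c)).hi : ℝ) + SC) ^ 2) / (100 * SC) ^ 2 by ring, div_lt_iff₀ (by positivity)]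
    linarith
  · -- (d) lower
    intro q hq
    have := mul_le_mul_of_nonneg_right (hd_le q hq) hS.le
    rw [div_le_iff₀ hS]
    linarith
  · -- (d) upper
    exact ⟨q₀, hq₀, by rw [le_div_iff₀ hS]; exact hDhi⟩
  · -- d2lo ≤ ‖U q‖²
    intro q hq
    rw [div_le_iff₀ hS]
    exact hDsq_lo q hq
  · -- (F1) the fit: `‖U q − ‖U q'‖ q‖ ≤ ‖V q‖ + ‖V q'‖ ≤ 2ρ`
    intro q hq q' hq'
    obtain ⟨b, hb, rfl⟩ := exists_label_of_mem_pattern hq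
    obtain ⟨b', hb', rfl⟩ := exists_label_of_mem_pattern hq'
    have hq1 : ‖fccPoint b‖ = 1 := norm_eq_one_of_mem_fccKissingPattern hq
    have hq1' : ‖fccPoint b'‖ = 1 := norm_eq_one_of_mem_fccKissingPattern hq'
    -- `|‖U q'‖ − λ| ≤ ‖V q'‖`
    have hdev : |‖U (fccPoint b')‖ - lam| ≤ ‖V (fccPoint b')‖ := by
      have h1 := abs_norm_sub_norm_le (U (fccPoint b')) (lam • fccPoint b')
      rw [norm_smul, Real.norm_eq_abs, abs_of_nonneg hlam0, hq1', mul_one] at h1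
      have h2 : U (fccPoint b') - lam • fccPoint b' = V (fccPoint b') := by rw [hV]; abel
      rwa [h2] at h1
    -- the triangle inequality for the misfit
    have htri : ‖U (fccPoint b) - ‖U (fccPoint b')‖ • fccPoint b‖ ≤ ‖V (fccPoint b)‖ + ‖V (fccPoint b')‖ := by
      have hsplit : U (fccPoint b) - ‖U (fccPoint b')‖ • fccPoint b = V (fccPoint b) + (lam - ‖U (fccPoint b')‖) • fccPoint b := by
        rw [hV, sub_smul]; abel
      rw [hsplit]
      calc ‖V (fccPoint b) + (lam - ‖U (fccPoint b')‖) • fccPoint b‖ ≤ ‖V (fccPoint b)‖ + ‖(lam - ‖U (fccPoint b')‖) • fccPoint b‖ :=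
            norm_add_le _ _
        _ = ‖V (fccPoint b)‖ + |lam - ‖U (fccPoint b')‖| := by rw [norm_smul, Real.norm_eq_abs, hq1, mul_one]
        _ ≤ ‖V (fccPoint b)‖ + ‖V (fccPoint b')‖ := by rw [abs_sub_comm]; linarith
    have hsq : ‖U (fccPoint b) - ‖U (fccPoint b')‖ • fccPoint b‖ ^ 2 ≤ 2 * ‖V (fccPoint b)‖ ^ 2 + 2 * ‖V (fccPoint b')‖ ^ 2 :=
      (pow_le_pow_left₀ (norm_nonneg _) htri 2).trans (by
        have hsq0 := sq_nonneg (‖V (fccPoint b)‖ - ‖V (fccPoint b')‖)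
        have e1 : (‖V (fccPoint b)‖ - ‖V (fccPoint b')‖) ^ 2 = ‖V (fccPoint b)‖ ^ 2 - 2 * (‖V (fccPoint b)‖ * ‖V (fccPoint b')‖) + ‖V (fccPoint b')‖ ^ 2 := by
          ring
        have e2 : (‖V (fccPoint b)‖ + ‖V (fccPoint b')‖) ^ 2 = ‖V (fccPoint b)‖ ^ 2 + 2 * (‖V (fccPoint b)‖ * ‖V (fccPoint b')‖) + ‖V (fccPoint b')‖ ^ 2 := by
          ring
        rw [e2]; rw [e1] at hsq0; linarith)
    have r1 := hrho b hb
    have r2 := hrho b' hb'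
    have hfitR : (4000000 : ℝ) * devMax c w (scaleL c) ≤ 2401 * (dSq c w (scaleL c)).lo := by exact_mod_cast hfitZ
    rw [show (49 / 1000 : ℝ) ^ 2 * (((dSq c w (scaleL c)).lo : ℝ) / SC) = 2401 * ((dSq c w (scaleL c)).lo : ℝ) / (1000000 * SC) by ring,
      le_div_iff₀ (by positivity)]
    have hsq' := mul_le_mul_of_nonneg_right hsq (by positivity : (0 : ℝ) ≤ 1000000 * SC)
    linarith
  · -- (F2) clean gap
    intro q hq
    obtain ⟨b, hb, rfl⟩ := exists_label_of_mem_pattern hq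
    have f3 := hK b hb
    have hC := (FI.mem_def.1 (hkiss b hb)).2
    have f3' : ((kissSq c w (scaleL c) b).hi : ℝ) * SC * 10000 ≤ (130 * (dEncl c w (scaleL c)).lo - SC) ^ 2 := by exact_mod_cast f3
    have h130' : (SC : ℝ) ≤ 130 * (dEncl c w (scaleL c)).lo := by exact_mod_cast h130
    have hC' := mul_le_mul_of_nonneg_right hC (by positivity : (0 : ℝ) ≤ SC * 10000)
    have hsq : (‖U (fccPoint b)‖ * (100 * SC)) ^ 2 ≤ ((130 : ℝ) * (dEncl c w (scaleL c)).lo - SC) ^ 2 := by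
      have e : (‖U (fccPoint b)‖ * (100 * SC)) ^ 2 = ‖U (fccPoint b)‖ ^ 2 * SC * (SC * 10000) := by ring
      rw [e]; linarith
    have hle := (abs_le_of_sq_le_sq' hsq (by linarith)).2
    rw [show (13 : ℝ) / 10 * (((dEncl c w (scaleL c)).lo : ℝ) / SC) - 1 / 100 = (130 * ((dEncl c w (scaleL c)).lo : ℝ) - SC) / (100 * SC) by
      field_simp; ring, le_div_iff₀ (by positivity)]
    exact hle
  · -- (F3) far
    intro b hb hb0 hrec
    rw [← box2_eq] at hb
    have f4 : ((130 : ℝ) * (dEncl c w (scaleL c)).hi + SC) ^ 2 ≤ ((qformFI (gramT c w) b).lo : ℝ) * SC * 10000 := by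
      exact_mod_cast hfar b hb hb0 hrec
    have hC := (FI.mem_def.1 (hN b)).1
    have hC' := mul_le_mul_of_nonneg_right hC (by positivity : (0 : ℝ) ≤ SC * 10000)
    have hsq : ((130 : ℝ) * (dEncl c w (scaleL c)).hi + SC) ^ 2 ≤ (‖latPt U fccVec b‖ * (100 * SC)) ^ 2 := by
      have e : (‖latPt U fccVec b‖ * (100 * SC)) ^ 2 = ‖latPt U fccVec b‖ ^ 2 * SC * (SC * 10000) := by ring
      rw [e]; linarith
    have hle := (abs_le_of_sq_le_sq' hsq (by positivity)).2
    rw [show (13 : ℝ) / 10 * (((dEncl c w (scaleL c)).hi : ℝ) / SC) + 1 / 100 = (130 * ((dEncl c w (scaleL c)).hi : ℝ) + SC) / (100 * SC) by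
      field_simp; ring, div_le_iff₀ (by positivity)]
    exact hle

/-! ## §3. The combined entry-leaf verdict and the fcc half -/

/-- ★ **ENTRY-LEAF VERDICT, (P1) ∨ (P4)**: fit prune ∨ (symmetry prune ∨ column prune ∨ v2 Gram-leaf checker). -/
def entryLeafOKF (μ : ℤ) (c w : Fin 3 × Fin 3 → ℤ) : Bool := fitOK c w || entryLeafOK μ c w

/-- ★ Soundness of `entryLeafOKF` (shape of `…HomEntryGram.fccHalf_of_entryTree`). [folklore] -/
theorem entryLeafOKF_sound {μ : ℤ} {c w : Fin 3 × Fin 3 → ℤ} (h : entryLeafOKF μ c w = true) (U : E3 →L[ℝ] E3)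
    (hsa : ∀ v v' : E3, ⟪U v, v'⟫ = ⟪v, U v'⟫) (hU : ‖U - 1‖ ≤ 1 / 4)
    (hbox : ∀ ab : Fin 3 × Fin 3, |(U (EuclideanSpace.single ab.2 (1 : ℝ))) ab.1 - (c ab : ℝ) / SC| ≤ (w ab : ℝ) / SC) :
    (∀ (M : ℕ) (z : Fin M → E3) (c : Fin M), Function.Injective z →
        Set.range z = {x : E3 | dist x (z c) ≤ 133 / 10 ∧ ∃ a : Fin 3 → ℤ, x = z c + latPt U fccVec a} →
        TightNearCap (9 / 5) (3 / 2) z c ∨ ExemptNear (9 / 5) ExRec z c ∨ BadNearCap (9 / 5) (3 / 2) z c) ∨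
      (μ : ℝ) / SC ≤ ∑ b ∈ (Fintype.piFinset fun _ : Fin 3 => Finset.Icc (-7 : ℤ) 7).filter (fun b => b ≠ 0),
        effPot w₄₅ ω₄ (3 / 400) ‖latPt U fccVec b‖ := by
  simp only [entryLeafOKF, Bool.or_eq_true] at h
  rcases h with h | h
  · exact Or.inl (fitOK_sound h U hU hbox)
  · exact entryLeafOK_sound h U hsa hU hbox

/-- ★★★ **THE fcc HALF OF `(H)` FROM ONE BOOLEAN, (P1) ∨ (P4) leaves**: `treeOK (entryLeafOKF μ) t rootC rootW = true` with `2 (m + e_W) SC ≤ μ` ⟹ the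
fcc hypothesis `hfcc` of `…HomPrunedPolar.homFloor_of_prunedBoxSums_selfAdjoint` for `m`, verbatim. [folklore] -/
theorem fccHalf_of_entryFitTree {m : ℝ} {μ : ℤ} (hμ : 2 * (m + (-(7175 / 10000) + 3 / 400)) * SC ≤ μ)
    {t : CertTree (Fin 3 × Fin 3)} (h : treeOK (entryLeafOKF μ) t rootC rootW = true) :
    ∀ U : E3 →L[ℝ] E3, (∀ v w : E3, inner ℝ (U v) w = inner ℝ v (U w)) → (∀ w : E3, 0 ≤ inner ℝ w (U w)) → ‖U - 1‖ ≤ 1 / 4 →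
      (∀ (M : ℕ) (z : Fin M → E3) (c : Fin M), Function.Injective z →
          Set.range z = {x : E3 | dist x (z c) ≤ 133 / 10 ∧ ∃ a : Fin 3 → ℤ, x = z c + latPt U fccVec a} →
          TightNearCap (9 / 5) (3 / 2) z c ∨ ExemptNear (9 / 5) ExRec z c ∨ BadNearCap (9 / 5) (3 / 2) z c) ∨
      m ≤ (∑ b ∈ (Fintype.piFinset fun _ : Fin 3 => Finset.Icc (-7 : ℤ) 7).filter (fun b => b ≠ 0),
        effPot w₄₅ ω₄ (3 / 400) ‖latPt U fccVec b‖) / 2 - (-(7175 / 10000) + 3 / 400) :=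
  fccHalf_of_entryTree hμ (entryLeafOKF μ) (fun _ _ hv U hsa hU hbox => entryLeafOKF_sound hv U hsa hU hbox) h

/-! ## §4. Kernel smoke tests: the fit prune FIRES on thin boxes at the unstrained lattices `U = λ·1`, and fails far from them -/

/-- `fitOK` accepts boxes of entry half-width `2⁻⁸` at `U = 1` and at `U = 0.97·1`, and rejects the uniaxially strained thin box `diag(1.1, 1, 1)`. -/
example : fitOK rootC (fun _ => 1099511627776) = true ∧
    fitOK (fun ab => if ab.1 = ab.2 then 273030727409336 else 0) (fun _ => 1099511627776) = true ∧
    fitOK (Function.update rootC (0, 0) 309622474381722) (fun _ => 0) = false := by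
  decide +kernel

end Summit.AtomisticToContinuum.Crystallization.Theorems.FrustratedLawDichotomyStrainedPatchHomEntryFit
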